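import Mathlib
import Summits.Ventures.HodgeRepro.GSetHodge
import Summits.Ventures.HodgeRepro.OcticCMPointWitness

/-!
# OcticCMPointGroup — the octic point in typer's `G`-set vocabulary (`IsComplexConj`, `IsCMTypeOn`, `IsHodgeSetOn`)

Blind re-derivation cell `pub-hodge-repro`, seat night-2 (gen 0).  Target tree path
`lean/Summits/Ventures/HodgeRepro/OcticCMPointGroup.lean`.  Continues `OcticCMPointWitness.lean`; uses
`CMType.lean` / `GSetHodge.lean` (seat typer).

`OcticCMPointWitness.lean` checks the CM point `B = A_Φ × A_{σΦ}` of `E = ℚ(ζ₅, √(4+√5))` with sixteen explicit maps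
`act g : X → X` (closed under composition, faithful).  This file gives the sixteen parameters `G = Fin 4 × Bool × Bool`
the GROUP LAW of composition (`galMul`, `galInv`, wrapped as the structure `Gal`; the group axioms through
faithfulness on `X` and the composition law, `act_galMul` / `act_galInv` by `decide`), the action on `X = Hom(E, F)`
and on `X ⊔ X` as `MulAction Gal` instances (the diagonal action on the second), and restates the point in the cell's
`G`-set vocabulary: `c` is a complex conjugation (`HodgeRepro.IsComplexConj`), `Φ` and `σΦ` are CM types on the `G`-set `X`
(`HodgeRepro.IsCMTypeOn`), the class of `Δ` is a Hodge set for the CM type `Φ_B` of `B` on `X ⊔ X`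
(`HodgeRepro.IsHodgeSetOn`) and is EXCEPTIONAL (`HodgeRepro.IsExceptionalOn`: Pohlmann's condition holds and
`Δ` is not conjugation-stable).  With these instances the octic point is an instance of the cell's general
`G`-set theorems (`GSetHodge.lean`, `CMHodge*.lean`, night-3 / night-4's face machinery) rather than a stand-alone
table.  Nothing here says anything about the status of the Hodge conjecture for CM abelian varieties, which is NOT
proved.
-/

set_option autoImplicit false

namespace Summit.Ventures.HodgeRepro.OcticCMPoint

open Finset
open scoped Pointwise

/-! ### The group law of composition on the sixteen parameters -/

/-- Composition `g ∘ g′` of two Galois elements: `ζ₅ ↦ ζ₅^{(a+1)(a′+1)}`; the signs compose through `g′`'s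
swap: if `a′ + 1 ∈ {1, 4}` then `(e₁e₁′, e₂e₂′)`, else `(e₂e₁′, e₁e₂′)` (signs as `Bool`, product = `==`). -/
def galMul (g g' : G) : G :=
  (jmul g.1 g'.1,
    if fixesSqrtFive g'.1 then (g.2.1 == g'.2.1) else (g.2.2 == g'.2.1),
    if fixesSqrtFive g'.1 then (g.2.2 == g'.2.2) else (g.2.1 == g'.2.2))

/-- The inverse: `a ↦ a⁻¹` in `(ℤ/5)^×` (`a³`); the signs swap when `a + 1 ∈ {2, 3}`. -/
def galInv (g : G) : G :=
  (jmul g.1 (jmul g.1 g.1), if fixesSqrtFive g.1 then g.2.1 else g.2.2,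
    if fixesSqrtFive g.1 then g.2.2 else g.2.1)

/-- The composition law IS composition of the actions. -/
theorem act_galMul : ∀ (g g' : G) (x : X), act (galMul g g') x = act g (act g' x) := by decide

/-- `galInv g` undoes `g` on `X`. -/
theorem act_galInv : ∀ (g : G) (x : X), act (galInv g) (act g x) = x := by decide

/-- **The Galois group `Gal(F/ℚ)`** as a structure wrapping the sixteen parameters (so that the group law below is
the only one on it). -/
structure Gal where
  /-- the parameter `(a, e₁, e₂)` -/
  val : G
  deriving Fintype, DecidableEq

namespace Gal

/-- Multiplication = composition (`galMul`). -/
instance : Mul Gal := ⟨fun g g' => ⟨galMul g.val g'.val⟩⟩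

/-- The identity `(1, +, +)`. -/
instance : One Gal := ⟨⟨(0, true, true)⟩⟩

/-- Inversion (`galInv`). -/
instance : Inv Gal := ⟨fun g => ⟨galInv g.val⟩⟩

/-- `(g * g′).val = galMul g.val g′.val`. -/
theorem mul_val (g g' : Gal) : (g * g').val = galMul g.val g'.val := rfl

/-- `(1 : Gal).val = (1, +, +)`. -/
theorem one_val : (1 : Gal).val = (0, true, true) := rfl

/-- `g⁻¹.val = galInv g.val`. -/
theorem inv_val (g : Gal) : g⁻¹.val = galInv g.val := rfl

/-- Two elements acting identically on `X` are equal (faithfulness). -/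
theorem ext_of_act {g g' : Gal} (h : ∀ x : X, act g.val x = act g'.val x) : g = g' := by
  cases g; cases g'
  exact congrArg Gal.mk (act_faithful _ _ h)

/-- **`Gal` is a group** — every axiom through faithfulness on `X` and the composition law (`act_galMul`,
`act_galInv`, `act_one`), no `4096`-case enumeration. -/
instance : Group Gal where
  mul_assoc a b c := ext_of_act fun x => by
    rw [mul_val, mul_val, mul_val, mul_val, act_galMul, act_galMul, act_galMul, act_galMul]
  one_mul a := ext_of_act fun x => by rw [mul_val, act_galMul, one_val, act_one]
  mul_one a := ext_of_act fun x => by rw [mul_val, act_galMul, one_val, act_one]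
  inv_mul_cancel a := ext_of_act fun x => by rw [mul_val, inv_val, act_galMul, act_galInv, one_val, act_one]

/-! ### The actions -/

/-- The action of `Gal` on `X = Hom(E, F)` by composition. -/
instance : MulAction Gal X where
  smul g x := act g.val x
  one_smul x := act_one x
  mul_smul g g' x := act_galMul g.val g'.val x

/-- `g • x = act g.val x`. -/
theorem smul_def (g : Gal) (x : X) : g • x = act g.val x := rfl

/-- The diagonal action of `Gal` on `X ⊔ X = Bool × X`. -/
instance : MulAction Gal XB where
  smul g p := actB g.val p
  one_smul p := by
    show actB (1 : Gal).val p = p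
    unfold actB
    rw [one_val, act_one]
  mul_smul g g' p := by
    show actB (g * g').val p = actB g.val (actB g'.val p)
    unfold actB
    rw [mul_val, act_galMul]

/-- `g • p = actB g.val p`. -/
theorem smulB_def (g : Gal) (p : XB) : g • p = actB g.val p := rfl

/-- Complex conjugation as an element of `Gal`. -/
def cG : Gal := ⟨c⟩

/-- `σ` as an element of `Gal`. -/
def σG : Gal := ⟨σ⟩

/-! ### The point in typer's vocabulary -/

/-- **`c` is a complex conjugation** of the Galois group (`CMType.lean`: `c ≠ 1`, `c * c = 1`, central). -/
theorem cG_isComplexConj : HodgeRepro.IsComplexConj cG := by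
  rw [HodgeRepro.isComplexConj_iff]
  decide

/-- **`Φ` is a CM type on the `Gal`-set `X`** (`GSetHodge.lean`: one of each pair `{x, c • x}`). -/
theorem phi_isCMTypeOn : HodgeRepro.IsCMTypeOn cG Φ := by decide

/-- **`σΦ = σG • Φ` is a CM type on the `Gal`-set `X`.** -/
theorem sigma_phi_isCMTypeOn : HodgeRepro.IsCMTypeOn cG (σG • Φ) := by decide

/-- `σG • Φ` is the set `σΦ` of `OcticCMPointWitness.lean`. -/
theorem sigmaG_smul_phi : σG • Φ = Φ.image (act σ) := by decide

/-- **`Φ_B` is a CM type on `X ⊔ X`** (the CM type of the product `B`). -/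
theorem phiB_isCMTypeOn : HodgeRepro.IsCMTypeOn cG ΦB := by decide

/-- **The class of `Δ` is a Hodge set for `Φ_B`** — Pohlmann's condition `|τΔ ∩ Φ_B| = |τΔ ∩ cΦ_B|` for every
`τ ∈ Gal` (`GSetHodge.lean`, `IsHodgeSetOn`; `Δ` has `4 = 2 · 2` points: the `(2,2)`-class of
`OcticCMPointWitness.lean`'s `delta_balanced`). -/
theorem delta_isHodgeSetOn : HodgeRepro.IsHodgeSetOn cG ΦB Δ := by decide

/-- **The class of `Δ` is EXCEPTIONAL** (`GSetHodge.lean`, `IsExceptionalOn`): a Hodge set that is not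
conjugation-stable — outside the conjugate-pair (divisor) part. -/
theorem delta_isExceptionalOn : HodgeRepro.IsExceptionalOn cG ΦB Δ := by decide

end Gal

end Summit.Ventures.HodgeRepro.OcticCMPoint
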